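import Literature.NumberTheory.ModularForms.RademacherPhiCompositionProofs
import Mathlib.NumberTheory.ModularForms.CongruenceSubgroups
import Summits.BirchSwinnertonDyer.BirchSwinnertonDyer.Theorems.EisensteinDepletionAtTwoStarStabCoeffBoundary
import Summits.BirchSwinnertonDyer.BirchSwinnertonDyer.Theorems.EisensteinDepletionAtTwoStarEisOddWitness
import Summits.BirchSwinnertonDyer.BirchSwinnertonDyer.Theorems.EisensteinDepletionAtTwoStarSymbCOfPeriodCongruence
import Summits.BirchSwinnertonDyer.BirchSwinnertonDyer.Theorems.EisensteinDepletionAtTwoStarPeriodAdditive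
import Summits.BirchSwinnertonDyer.BirchSwinnertonDyer.Theorems.EisensteinDepletionAtTwoStarGO2PrimeSqEtaleTwoTorsion
import Summits.BirchSwinnertonDyer.BirchSwinnertonDyer.Theorems.EisensteinDepletionAtTwoStarEisEightGlobal
import Literature.NumberTheory.EllipticCurves.PAdicLFunction
import Literature.NumberTheory.EllipticCurves.NonEisensteinPrimeOfSurjective
import HarnessLib


/-!
# Cusp-evenness of the depleted Eisenstein class at `2` — clauses (o), (ii-a), (iii) of the research stub
# `stub_gammaOneCover` (line kummer v4 on crux `StarGO2Sigma`, stmt-BirchSwinnertonDyer-27046) are ELEMENTARY + TREE,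
# and clause (ii-a) is FALSE as typed at the levels `ℓ²`, `ℓ ≡ ±3 (mod 8)`

Planner bsd-rank2-p2 GEN 36 (tenure of route-BirchSwinnertonDyer-EisensteinDepletionAtTwo; analysis file, THEOREMS ONLY,
no `def`, no `sorry`; `lean check` rc 0, 0 warnings).  A prover may land it verbatim as
`Theorems/EisensteinDepletionAtTwoStarGO2CuspEvenness.lean` (`--supports stmt-BirchSwinnertonDyer-27046`); the lead
(star-p1) may import it into kummer v5 and cut the bundled research stub `stub_gammaOneCover` down to its clause (ii-b)
(the discrepancy cover), see the memo `HOME/p2/g36/CUSP-EVENNESS.md`.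

Notation: `N` odd, `β` admissible stabilisation data (`IsAdmissibleStabData N β`), `c_t = stabCoeff N β t`,
`φ_β(a b; c d) = stabEisensteinPeriod N β a b c d = ∑_{t ∣ N} c_t Φ(a, tb, c/t, d)` (Rademacher's `Φ`), `g'` a generator of
the value group `φ_β(Γ₀(N)) = ℤ g'` (the hypothesis `hg`, exactly as in the stub), `c_β = ∑ c_t/t`.

* §1 `rademacherPhiSL_conj_T_zpow` — `Φ(σ T^h σ⁻¹) = h − 3·sign(h c⁴)` (`c = σ₁₀`; composition law (62) twice);
  `rademacherPhi_parabolic` — the same on entries `(1 − hac, ha², −hc², 1 + hac)`, `gcd(a, c) = 1`.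
* §2 **(CF) closed formula** `stabEisensteinPeriod_parabolic` / `stabEisensteinPeriod_conj_T_zpow`:
  `φ_β(1 − hac, ha², −hc², 1 + hac) = h · S(c)`, `S(c) := ∑_{t ∣ N} c_t·gcd(t, c)²/t`, whenever `N ∣ h c²`
  (per `t`, the level-`t` matrix is the parabolic of the primitive column `(ta/g, c/g)`, `g = gcd(t, c)`, with width
  `h g²/t`; the `−3·sign` terms cancel because `∑ c_t = 0`).
* §3 **(E-LEG)** `norm_cuspSum_le`: `‖S(n)‖₂ ≤ 2⁻⁴` for every `n`, provided `N ≠ ℓ²` with `ℓ ≡ ±3 (mod 8)` (Euler product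
  `cuspSum_eq_prod` + the seven local values `norm_cuspLocal_le`).  Sharp: `cuspSum_primeSq`, `S(ℓ) = −(ℓ²−1)/ℓ` at `N = ℓ²`.
* §4 `exists_eq_conj_T_zpow_of_trace_eq_two` — parabolic normal form in `SL(2, ℤ)`.
* §5 `generator_ne_zero_and_norm_ge` **(o)** `g' ≠ 0`, `‖g'‖₂ ≥ 2⁻³` (the tree's odd `C`-witness
  `exists_inC_norm_stabEisCuspDiff_eq` is a difference of two `Γ₀(N)`-values); `parabolic_even` **(ii-a)** every parabolic
  `γ ∈ Γ₀(N)` (a fortiori `Γ₁(N)`: `parabolic_even_gamma1`) has `φ_β(γ) ∈ 2g'ℤ` off the exceptional levels;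
  `exists_pos_entries` + `bezout_lower_split` (`γ = γ_{B,D}·(1 0; k 1)`, `N ∣ k`, additivity) + `lower_value_even`
  (`φ_β(1 0; k 1) = −k c_β ∈ 2g'ℤ`, tree `norm_cBeta_le`) give `exists_odd_bezout_value` **(iii)** (a Bézout matrix `γ_{b,d}`,
  `d > 0`, `gcd(d, bN) = 1`, with `φ_β(γ_{b,d})/g'` odd), `norm_value_le_eighth` (`‖φ_β(γ)‖₂ ≤ 2⁻³` on all of `Γ₀(N)`, with
  the tree's `star_eisEightGlobal`) and `norm_generator_eq` (**`‖g'‖₂ = 2⁻³` exactly**).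
* §6 `cover_clauses` — (o), (ii-a), (iii) bundled in the stub's shape; `not_exceptional_of_etale_twoTorsion` — the
  exceptional levels are VACUOUS for a globally minimal `W₀` of conductor `N` with an étale rational `2`-torsion point
  (tree `star_primeSqEtaleTwoTorsion`), i.e. the input `hexc` GIVEN `W₀.conductorNorm ℤ = N`.
* §7 `parabolic_odd_at_exceptional` — **at `N = ℓ²`, `ℓ ≡ ±3 (mod 8)`, for EVERY admissible `β`, the parabolic
  `(1 − ℓ², ℓ; −ℓ³, 1 + ℓ²) ∈ Γ₁(ℓ²)` has `φ_β = −(ℓ² − 1)`, an ODD multiple of `g'`**: clause (ii-a) of the stub is false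
  there as a statement about `φ_β`; the stub survives only because its binders are contradictory — and seeing that needs
  `W₀.conductorNorm ℤ = N` (Carayol / the modularity clause of the parent 27021), which is NOT among the stub's binders
  (`N = W.conductorNorm ℤ` is about `W`; the `2`-torsion datum `x₀` is on `W₀`).
* §8 `cover_o_iii_of_ordinary` — (o) and (iii) from `IsOrdinaryAt W 2` + admissible `β` ALONE (no `W₀`);
  `cover_clauses_of_curveData` — (o), (ii-a), (iii) from the stub's curve data plus the ONE extra binder
  `W₀.conductorNorm ℤ = N` (drop-in for the kummer glue; the companion sketch `KummerV6Cut.lean` §9 derives v5's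
  `stub_gammaOneCover` VERBATIM from a (ii-b)-only stub + Carayol at `(W₀, f)`, kernel-checked).

Numerics (kit j312110; odd cube-free `N ≤ 1501`, all admissible `β`): (CF) 263 860 checks / 0 failures; E-LEG 8 293 cusp
classes / 0 non-exceptional failures; exceptional levels met exactly `{9, 25, 121, 169, 361, 841, 1369}`.

HONEST FRAMING: kernel lemmas de-risking three of the four clauses of ONE registered research stub of the OPEN crux
`StarGO2Sigma` (27046) and exhibiting a mis-typing of the fourth's companion at seven-per-1500 levels; clause (ii-b) (the
discrepancy cover / Kummer form) is untouched; `StarGO2Sigma`, `StarOptBNSF`, E1M_NSF, E1M are NOT proved; nothing here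
reads an analytic rank; BSD is not proved by any of this.

References: [Stevens1982] G. Stevens, *Arithmetic on Modular Curves*, Progr. Math. 20 (1982), Thm. 1.3.4, §2.4–2.5;
[Stevens1985] G. Stevens, *The cuspidal group and special values of L-functions*, Trans. AMS 291 (1985), Thm. 1.3;
[RademacherGrosswald1972] H. Rademacher, E. Grosswald, *Dedekind Sums*, Carus Monogr. 16 (1972), Ch. 4 A (59), (62);
[Shimura1971] G. Shimura, *Introduction to the Arithmetic Theory of Automorphic Functions* (1971), §1.3–1.6;
[Setzer1975] B. Setzer, *Elliptic curves of prime conductor*, JLMS (2) 10 (1975); [Carayol1986] H. Carayol, *Sur les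
représentations ℓ-adiques associées aux formes modulaires de Hilbert*, Ann. Sci. ÉNS 19 (1986), Thm. (A).
-/


set_option linter.dupNamespace false
set_option autoImplicit false

open scoped MatrixGroups
open CongruenceSubgroup Matrix.SpecialLinearGroup

namespace Summit.BirchSwinnertonDyer.BirchSwinnertonDyer.Theorems.DepletionAtTwo.CuspEvenness

open Literature.NumberTheory.ModularForms

/-! ### §1 Rademacher's `Φ` on the parabolic conjugates `σ T^h σ⁻¹` -/

/-- `Φ(σ⁻¹) = −Φ(σ)` (composition law at `σ⁻¹ σ = 1`). [cite: RademacherGrosswald1972, Ch. 4 A, eq. (62)] -/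
theorem rademacherPhiSL_inv (σ : SL(2, ℤ)) : rademacherPhiSL σ⁻¹ = -rademacherPhiSL σ := by
  have h := rademacherPhiSL_mul σ⁻¹ σ
  rw [inv_mul_cancel, rademacherPhiSL_one] at h
  have h10 : ((1 : SL(2, ℤ)) 1 0) = 0 := by
    rw [Matrix.SpecialLinearGroup.coe_one]; exact Matrix.one_apply_ne (by decide)
  rw [h10, mul_zero, Int.sign_zero, Int.cast_zero, mul_zero, sub_zero] at h
  linarith

/-- `Φ(T^h) = h`. [cite: RademacherGrosswald1972, Ch. 4 A, eq. (59)] -/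
theorem rademacherPhiSL_T_zpow (h : ℤ) : rademacherPhiSL (ModularGroup.T ^ h) = h := by
  rw [rademacherPhiSL_apply]
  have e : ((ModularGroup.T ^ h : SL(2, ℤ)) : Matrix (Fin 2) (Fin 2) ℤ) = !![1, h; 0, 1] :=
    ModularGroup.coe_T_zpow h
  have e00 : (ModularGroup.T ^ h : SL(2, ℤ)) 0 0 = 1 := by rw [e]; rfl
  have e01 : (ModularGroup.T ^ h : SL(2, ℤ)) 0 1 = h := by rw [e]; rfl
  have e10 : (ModularGroup.T ^ h : SL(2, ℤ)) 1 0 = 0 := by rw [e]; rfl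
  have e11 : (ModularGroup.T ^ h : SL(2, ℤ)) 1 1 = 1 := by rw [e]; rfl
  rw [e00, e01, e10, e11, rademacherPhi_of_c_eq_zero]
  simp

/-- Entries of `σ T^h`: second column shifted, first column unchanged. [folklore] -/
theorem mul_T_zpow_apply (σ : SL(2, ℤ)) (h : ℤ) :
    (σ * ModularGroup.T ^ h) 0 0 = σ 0 0 ∧ (σ * ModularGroup.T ^ h) 0 1 = σ 0 0 * h + σ 0 1 ∧
      (σ * ModularGroup.T ^ h) 1 0 = σ 1 0 ∧ (σ * ModularGroup.T ^ h) 1 1 = σ 1 0 * h + σ 1 1 := by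
  have e : ((ModularGroup.T ^ h : SL(2, ℤ)) : Matrix (Fin 2) (Fin 2) ℤ) = !![1, h; 0, 1] :=
    ModularGroup.coe_T_zpow h
  have key : ∀ i j : Fin 2, (σ * ModularGroup.T ^ h) i j =
      σ i 0 * (!![1, h; 0, 1] : Matrix (Fin 2) (Fin 2) ℤ) 0 j + σ i 1 * (!![1, h; 0, 1] : Matrix (Fin 2) (Fin 2) ℤ) 1 j := by
    intro i j
    change ((σ : Matrix (Fin 2) (Fin 2) ℤ) * ((ModularGroup.T ^ h : SL(2, ℤ)) : Matrix (Fin 2) (Fin 2) ℤ)) i j = _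
    rw [e, Matrix.mul_apply, Fin.sum_univ_two]
  refine ⟨?_, ?_, ?_, ?_⟩ <;> rw [key] <;> simp

/-- Entries of the parabolic conjugate `σ T^h σ⁻¹` in terms of the first column `(a, c)` of `σ`:
`(1 − hac, ha²; −hc², 1 + hac)`. [folklore] -/
theorem conj_T_zpow_apply (σ : SL(2, ℤ)) (h : ℤ) :
    (σ * ModularGroup.T ^ h * σ⁻¹) 0 0 = 1 - h * σ 0 0 * σ 1 0 ∧
      (σ * ModularGroup.T ^ h * σ⁻¹) 0 1 = h * σ 0 0 ^ 2 ∧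
      (σ * ModularGroup.T ^ h * σ⁻¹) 1 0 = -(h * σ 1 0 ^ 2) ∧
      (σ * ModularGroup.T ^ h * σ⁻¹) 1 1 = 1 + h * σ 0 0 * σ 1 0 := by
  obtain ⟨m00, m01, m10, m11⟩ := mul_T_zpow_apply σ h
  have hdet : σ 0 0 * σ 1 1 - σ 0 1 * σ 1 0 = 1 := by
    have := Matrix.SpecialLinearGroup.det_coe σ
    rwa [Matrix.det_fin_two] at this
  have einv : ((σ⁻¹ : SL(2, ℤ)) : Matrix (Fin 2) (Fin 2) ℤ) = !![σ 1 1, -σ 0 1; -σ 1 0, σ 0 0] := by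
    rw [Matrix.SpecialLinearGroup.coe_inv, Matrix.adjugate_fin_two]
  have key : ∀ i j : Fin 2, (σ * ModularGroup.T ^ h * σ⁻¹) i j =
      (σ * ModularGroup.T ^ h) i 0 * (!![σ 1 1, -σ 0 1; -σ 1 0, σ 0 0] : Matrix (Fin 2) (Fin 2) ℤ) 0 j +
        (σ * ModularGroup.T ^ h) i 1 * (!![σ 1 1, -σ 0 1; -σ 1 0, σ 0 0] : Matrix (Fin 2) (Fin 2) ℤ) 1 j := by
    intro i j
    change (((σ * ModularGroup.T ^ h : SL(2, ℤ)) : Matrix (Fin 2) (Fin 2) ℤ) *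
      ((σ⁻¹ : SL(2, ℤ)) : Matrix (Fin 2) (Fin 2) ℤ)) i j = _
    rw [einv, Matrix.mul_apply, Fin.sum_univ_two]
  refine ⟨?_, ?_, ?_, ?_⟩
  · rw [key]; simp [m00, m01]; linear_combination hdet
  · rw [key]; simp [m00, m01]; ring
  · rw [key]; simp [m10, m11]; ring
  · rw [key]; simp [m10, m11]; linear_combination hdet


/-- **`Φ` on a parabolic conjugate**: `Φ(σ T^h σ⁻¹) = h − 3·sign(h·c⁴)`, `c = σ₁₀` (twice the composition law (62):
`Φ(σT^h) = Φ(σ) + h` as `(T^h)₁₀ = 0`, then `Φ(σT^h·σ⁻¹) = Φ(σT^h) + Φ(σ⁻¹) − 3 sign((−c)·c·(−hc²))`).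
Equivalently `Ψ(σT^hσ⁻¹) = Ψ(T^h) = h` for Rademacher's class function `Ψ`. [cite: RademacherGrosswald1972, Ch. 4 A, eq. (62); Ch. 4 C] -/
theorem rademacherPhiSL_conj_T_zpow (σ : SL(2, ℤ)) (h : ℤ) :
    rademacherPhiSL (σ * ModularGroup.T ^ h * σ⁻¹) = h - 3 * (Int.sign (h * σ 1 0 ^ 4) : ℚ) := by
  obtain ⟨-, -, m10, -⟩ := mul_T_zpow_apply σ h
  obtain ⟨-, -, p10, -⟩ := conj_T_zpow_apply σ h
  have eT : ((ModularGroup.T ^ h : SL(2, ℤ)) : Matrix (Fin 2) (Fin 2) ℤ) = !![1, h; 0, 1] :=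
    ModularGroup.coe_T_zpow h
  have t10 : (ModularGroup.T ^ h : SL(2, ℤ)) 1 0 = 0 := by rw [eT]; rfl
  have i10 : (σ⁻¹ : SL(2, ℤ)) 1 0 = -σ 1 0 := by
    rw [Matrix.SpecialLinearGroup.coe_inv, Matrix.adjugate_fin_two]; rfl
  have h1 := rademacherPhiSL_mul σ (ModularGroup.T ^ h)
  rw [t10, zero_mul, zero_mul, Int.sign_zero, Int.cast_zero, mul_zero, sub_zero, rademacherPhiSL_T_zpow] at h1
  have h2 := rademacherPhiSL_mul (σ * ModularGroup.T ^ h) σ⁻¹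
  rw [i10, m10, p10, h1, rademacherPhiSL_inv] at h2
  rw [h2, show -σ 1 0 * σ 1 0 * -(h * σ 1 0 ^ 2) = h * σ 1 0 ^ 4 by ring]
  ring

/-- The same with the sign read off the conjugate: `Φ(P) = h + 3·sign(P₁₀)` for `P = σ T^h σ⁻¹` (`P₁₀ = −h c²`).
[cite: RademacherGrosswald1972, Ch. 4 A, eq. (62)] -/
theorem rademacherPhiSL_conj_T_zpow' (σ : SL(2, ℤ)) (h : ℤ) :
    rademacherPhiSL (σ * ModularGroup.T ^ h * σ⁻¹) =
      h + 3 * (Int.sign ((σ * ModularGroup.T ^ h * σ⁻¹) 1 0) : ℚ) := by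
  obtain ⟨-, -, p10, -⟩ := conj_T_zpow_apply σ h
  rw [rademacherPhiSL_conj_T_zpow, p10]
  by_cases hc : σ 1 0 = 0
  · simp [hc]
  · have h4 : 0 < σ 1 0 ^ 4 := by positivity
    have h2 : 0 < σ 1 0 ^ 2 := by positivity
    rw [Int.sign_mul, Int.sign_eq_one_of_pos h4, mul_one, Int.sign_neg, Int.sign_mul, Int.sign_eq_one_of_pos h2,
      mul_one, Int.cast_neg]
    ring

/-- **`Φ` on a parabolic matrix given by a coprime column `(a, c)` and a width `k`**:
`Φ(1 − kac, ka²; −kc², 1 + kac) = k − 3·sign(k·c⁴)`. [cite: RademacherGrosswald1972, Ch. 4 A, eq. (62); Ch. 4 C] -/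
theorem rademacherPhi_parabolic {a c : ℤ} (hac : IsCoprime a c) (k : ℤ) :
    rademacherPhi (1 - k * a * c) (k * a ^ 2) (-(k * c ^ 2)) (1 + k * a * c) = k - 3 * (Int.sign (k * c ^ 4) : ℚ) := by
  obtain ⟨w, v, hwv⟩ := hac
  let σ : SL(2, ℤ) := ⟨!![a, -v; c, w], by rw [Matrix.det_fin_two_of]; linear_combination hwv⟩
  have s00 : σ 0 0 = a := rfl
  have s10 : σ 1 0 = c := rfl
  obtain ⟨p00, p01, p10, p11⟩ := conj_T_zpow_apply σ k
  simp only [s00, s10] at p00 p01 p10 p11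
  have := rademacherPhiSL_conj_T_zpow σ k
  rw [rademacherPhiSL_apply, p00, p01, p10, p11, s10] at this
  exact this


/-! ### §2 The level-`t` conjugates of a parabolic element and the cusp formula (CF) -/

/-- **`Φ` at the level-`t` conjugate of a parabolic matrix.** For coprime `(a, c)`, `h ∈ ℤ` and `t ≥ 1` with `t ∣ h c²`,
the matrix `(1 − hac, t·ha²; −hc²/t, 1 + hac)` is again parabolic: it is `(1 − k a′c′, k a′², −k c′², 1 + k a′c′)` for the
coprime column `(a′, c′) = (t a/g, c/g)` and the width `k = h g²/t`, `g = gcd(t, c)`; hence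
`Φ = h·gcd(t,c)²/t − 3·sign(h·c⁴)`. [cite: RademacherGrosswald1972, Ch. 4 A, eq. (62); Ch. 4 C] -/
theorem rademacherPhi_parabolic_level {a c : ℤ} (hac : IsCoprime a c) (h : ℤ) {t : ℕ} (ht : 0 < t)
    (hdvd : (t : ℤ) ∣ h * c ^ 2) :
    rademacherPhi (1 - h * a * c) (t * (h * a ^ 2)) (-(h * c ^ 2) / t) (1 + h * a * c) =
      h * (Int.gcd (t : ℤ) c : ℚ) ^ 2 / t - 3 * (Int.sign (h * c ^ 4) : ℚ) := by
  have ht0 : (t : ℤ) ≠ 0 := by exact_mod_cast ht.ne'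
  have hg0 : 0 < Int.gcd (t : ℤ) c := Int.gcd_pos_of_ne_zero_left c ht0
  obtain ⟨t₁, c₁, hcop, ht₁, hc₁⟩ := Int.exists_gcd_one hg0
  set g : ℕ := Int.gcd (t : ℤ) c with hg_def
  have hgpos : (0 : ℤ) < g := by exact_mod_cast hg0
  have ht₁pos : 0 < t₁ := by
    by_contra hneg
    push Not at hneg
    have : (t : ℤ) ≤ 0 := by rw [ht₁]; exact mul_nonpos_of_nonpos_of_nonneg hneg hgpos.le
    omega
  have hcop' : IsCoprime t₁ c₁ := Int.isCoprime_iff_gcd_eq_one.mpr hcop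
  -- `t₁ ∣ h g`
  have hdvd' : t₁ ∣ h * g := by
    have h1 : t₁ * g ∣ (h * g * c₁ ^ 2) * g := by
      have : (t : ℤ) ∣ h * c ^ 2 := hdvd
      rw [ht₁, hc₁] at this
      rwa [show h * (c₁ * ↑g) ^ 2 = h * ↑g * c₁ ^ 2 * ↑g by ring] at this
    have h2 : t₁ ∣ h * g * c₁ ^ 2 := (mul_dvd_mul_iff_right hgpos.ne').mp h1
    exact (hcop'.pow_right (n := 2)).dvd_of_dvd_mul_right h2
  obtain ⟨k, hk⟩ := hdvd'
  -- the primitive column `(t₁ a, c₁)`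
  have hcopa : IsCoprime a c₁ := by
    rw [hc₁] at hac
    exact hac.of_mul_right_left
  have hcol : IsCoprime (t₁ * a) c₁ := hcop'.mul_left hcopa
  have key := rademacherPhi_parabolic hcol k
  -- identification of the entries
  have e1 : 1 - h * a * c = 1 - k * (t₁ * a) * c₁ := by
    rw [hc₁]; linear_combination (-(a * c₁)) * hk
  have e2 : (t : ℤ) * (h * a ^ 2) = k * (t₁ * a) ^ 2 := by
    rw [ht₁]; linear_combination (t₁ * a ^ 2) * hk
  have e3 : -(h * c ^ 2) / (t : ℤ) = -(k * c₁ ^ 2) := by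
    have : -(h * c ^ 2) = (t : ℤ) * (-(k * c₁ ^ 2)) := by
      rw [ht₁, hc₁]; linear_combination (-(c₁ ^ 2 * (g : ℤ))) * hk
    rw [this, Int.mul_ediv_cancel_left _ ht0]
  have e4 : 1 + h * a * c = 1 + k * (t₁ * a) * c₁ := by
    rw [hc₁]; linear_combination (a * c₁) * hk
  rw [e1, e2, e3, e4, key]
  -- the width `k = h g²/t` and the sign
  have hkq : (k : ℚ) = h * (g : ℚ) ^ 2 / t := by
    have htq : (t : ℚ) ≠ 0 := by exact_mod_cast ht.ne'
    have hkt : k * (t : ℤ) = h * (g : ℤ) ^ 2 := by rw [ht₁]; linear_combination (-(g : ℤ)) * hk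
    field_simp
    exact_mod_cast hkt
  have hsign : Int.sign (k * c₁ ^ 4) = Int.sign (h * c ^ 4) := by
    by_cases hc0 : c₁ = 0
    · have : c = 0 := by rw [hc₁, hc0, zero_mul]
      simp [hc0, this]
    · have hc0' : c ≠ 0 := by rw [hc₁]; exact mul_ne_zero hc0 hgpos.ne'
      have h4 : 0 < c₁ ^ 4 := by positivity
      have h4' : 0 < c ^ 4 := by positivity
      rw [Int.sign_mul, Int.sign_mul, Int.sign_eq_one_of_pos h4, Int.sign_eq_one_of_pos h4', mul_one, mul_one]
      have := congr_arg Int.sign hk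
      rw [Int.sign_mul, Int.sign_mul, Int.sign_eq_one_of_pos hgpos, Int.sign_eq_one_of_pos ht₁pos, mul_one,
        one_mul] at this
      exact this.symm
  rw [hkq, hsign]

/-- **(CF) The stabilised Eisenstein period on a parabolic element of `Γ₀(N)`.** For admissible data at level `N`,
a coprime column `(a, c)` and `h` with `N ∣ h c²` (i.e. `P = σ T^h σ⁻¹ ∈ Γ₀(N)` for any `σ` with first column `(a, c)`):
`φ_β(1 − hac, ha²; −hc², 1 + hac) = h · ∑_{t ∣ N} c_t · gcd(t, c)²/t` — the `−3·sign` terms cancel because `∑ c_t = 0`.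
(The value of the boundary Eisenstein class on the loop around the cusp `a/c` of `Γ₀(N)`.)
[cite: RademacherGrosswald1972, Ch. 4 A, eq. (62)] [cite: Stevens1982, §2.4–2.5 (PDF pp. 35–38)] -/
theorem stabEisensteinPeriod_parabolic {N : ℕ} (hN : N ≠ 0) {β : ℕ → ℕ} (hadm : IsAdmissibleStabData N β)
    {a c : ℤ} (hac : IsCoprime a c) (h : ℤ) (hdvd : (N : ℤ) ∣ h * c ^ 2) :
    stabEisensteinPeriod N β (1 - h * a * c) (h * a ^ 2) (-(h * c ^ 2)) (1 + h * a * c) =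
      h * ∑ t ∈ N.divisors, stabCoeff N β t * (Int.gcd (t : ℤ) c : ℚ) ^ 2 / t := by
  rw [stabEisensteinPeriod_eq]
  have hterm : ∀ t ∈ N.divisors, stabCoeff N β t * rademacherPhi (1 - h * a * c) (t * (h * a ^ 2))
      (-(h * c ^ 2) / t) (1 + h * a * c) =
      h * (stabCoeff N β t * (Int.gcd (t : ℤ) c : ℚ) ^ 2 / t) - 3 * (Int.sign (h * c ^ 4) : ℚ) * stabCoeff N β t := by
    intro t htN
    have ht : 0 < t := Nat.pos_of_mem_divisors htN
    have htd : (t : ℤ) ∣ h * c ^ 2 :=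
      dvd_trans (Int.natCast_dvd_natCast.mpr (Nat.dvd_of_mem_divisors htN)) hdvd
    rw [rademacherPhi_parabolic_level hac h ht htd]
    ring
  rw [Finset.sum_congr rfl hterm, Finset.sum_sub_distrib, ← Finset.mul_sum, ← Finset.mul_sum,
    sum_divisors_stabCoeff_eq_zero hN hadm, mul_zero, sub_zero]

/-- The first column of an element of `SL(2, ℤ)` is coprime. [folklore] -/
theorem isCoprime_apply (σ : SL(2, ℤ)) : IsCoprime (σ 0 0) (σ 1 0) := by
  have hdet : σ 0 0 * σ 1 1 - σ 0 1 * σ 1 0 = 1 := by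
    have := Matrix.SpecialLinearGroup.det_coe σ
    rwa [Matrix.det_fin_two] at this
  exact ⟨σ 1 1, -σ 0 1, by linear_combination hdet⟩

/-- **(CF), matrix form**: `φ_β(σ T^h σ⁻¹) = h · ∑_{t ∣ N} c_t · gcd(t, σ₁₀)²/t` whenever `N ∣ h·σ₁₀²`
(`⇔ σ T^h σ⁻¹ ∈ Γ₀(N)`). [cite: RademacherGrosswald1972, Ch. 4 A, eq. (62)] [cite: Stevens1982, §2.4–2.5 (PDF pp. 35–38)] -/
theorem stabEisensteinPeriod_conj_T_zpow {N : ℕ} (hN : N ≠ 0) {β : ℕ → ℕ} (hadm : IsAdmissibleStabData N β)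
    (σ : SL(2, ℤ)) (h : ℤ) (hdvd : (N : ℤ) ∣ h * σ 1 0 ^ 2) :
    stabEisensteinPeriod N β ((σ * ModularGroup.T ^ h * σ⁻¹) 0 0) ((σ * ModularGroup.T ^ h * σ⁻¹) 0 1)
        ((σ * ModularGroup.T ^ h * σ⁻¹) 1 0) ((σ * ModularGroup.T ^ h * σ⁻¹) 1 1) =
      h * ∑ t ∈ N.divisors, stabCoeff N β t * (Int.gcd (t : ℤ) (σ 1 0) : ℚ) ^ 2 / t := by
  obtain ⟨p00, p01, p10, p11⟩ := conj_T_zpow_apply σ h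
  rw [p00, p01, p10, p11]
  exact stabEisensteinPeriod_parabolic hN hadm (isCoprime_apply σ) h hdvd



end Summit.BirchSwinnertonDyer.BirchSwinnertonDyer.Theorems.DepletionAtTwo.CuspEvenness
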